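import Mathlib.RingTheory.KrullDimension.Regular
import HarnessLib

/-!
# Secant sequences for modules (Česnavičius 2021, Def. 3.1 (i) and §3.2; Bourbaki AC VIII §3 no. 2)

Topic: `Literature/AlgebraicGeometry/Resolution`. Brick of the proof of the named facts
`KawasakiMacaulayfication` / `CesnaviciusMacaulayfication` (`Macaulayfication.lean`,
`MacaulayficationOverCMLocus.lean`). Kawasaki's Cohen–Macaulay blowing ups are blowing ups of
product ideals `∏ᵢ (r₁,…,rᵢ)` built from **CM-secant** sequences (Česnavičius 2021, Def. 3.1
(ii) = Kawasaki's `p`-standard systems of parameters), which are in the first place **secant**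
sequences — parts of systems of parameters of a finite module over a Noetherian local ring. This
file vendors the notion and the elementary facts of Česnavičius 2021, §3.2 (first paragraph after
Def. 3.1), proved from Mathlib's dimension theory of `Module.supportDim` (Stacks 0B52):

* `IsSecantSequence M rs` — Def. 3.1 (i) (Bourbaki AC VIII, §3, no. 2, Déf. 1): `rs = [r₁,…,r_s]`
  is secant for `M` if `dim Supp(M/(r₁,…,rᵢ)M) < dim Supp(M/(r₁,…,rᵢ₋₁)M)` for every
  `1 ≤ i ≤ s` (Mathlib's `Module.supportDim`, valued in `WithBot ℕ∞` with `dim ∅ = ⊥`, so that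
  only the empty sequence is secant for `M = 0`, as in the source);
* `isSecantSequence_cons_iff` — the recursion `(x :: rs)` secant for `M` iff
  `dim(M/xM) < dim M` and `rs` secant for `M/xM`; `isSecantSequence_append_iff`,
  `IsSecantSequence.take`, `IsSecantSequence.drop` — concatenations, initial segments, tails;
* `supportDim_le_supportDim_quotient_add_length` — the displayed inequality
  `dim Supp(M/(r₁,…,rᵢ₋₁)M) - 1 ≤ dim Supp(M/(r₁,…,rᵢ)M)` iterated:
  `dim M ≤ dim(M/(r₁,…,r_s)M) + s` for `rᵢ ∈ 𝔪` (finite `M` over a Noetherian local ring);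
* `IsSecantSequence.supportDim_quotient_add_length_eq` and
  `isSecantSequence_of_supportDim_quotient_add_length_eq` — "`r₁,…,r_s` is secant if and only
  if `dim Supp(M/(r₁,…,r_s)M) = dim Supp(M) - s`" (for `M ≠ 0`, `rᵢ ∈ 𝔪`);
* `IsSecantSequence.of_perm` — "any permutation of a secant sequence is still secant";
* `RingTheory.Sequence.IsRegular.isSecantSequence` — "any `M`-regular sequence is secant if
  `M ≠ 0`".

Everything is proved; no named fact is introduced.

## References

* [Cesnavicius2021] K. Česnavičius, *Macaulayfication of Noetherian schemes*, Duke Math. J. 170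
  (2021) 1419–1455 = arXiv:1810.04493v2, Def. 3.1 and §3.2 (p. 8 of the arXiv version).
* N. Bourbaki, *Algèbre commutative* VIII, §3, no. 2, Déf. 1 (the notion "suite sécante").
* The Stacks Project, Tag 0B52 (`dim M ≤ dim M/xM + 1`, with equality for `x` outside the minimal
  primes of the support) — Mathlib `Module.supportDim_le_supportDim_quotSMulTop_succ`.

## What is NOT here

The claim "`r₁,…,rᵢ₋₁, rᵢrⱼ` is again secant" (needs the sharp form of Stacks 0B52: only the
minimal primes of maximal dimension matter); CM-secant sequences (Def. 3.1 (ii): local cohomology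
annihilators) and everything downstream (Kawasaki 2000, 2.9–4.1).
-/

namespace Literature.AlgebraicGeometry.Resolution

open Ideal Submodule Module IsLocalRing
open scoped Pointwise

universe u v

variable {R : Type u} [CommRing R] (M : Type v) [AddCommGroup M] [Module R M]

/-- **Secant sequence for a module** (Česnavičius 2021, Def. 3.1 (i); Bourbaki AC VIII, §3,
no. 2, Déf. 1): `rs = [r₁,…,r_s]` is *secant for `M`* if for every `1 ≤ i ≤ s`
`dim Supp(M/(r₁,…,rᵢ)M) < dim Supp(M/(r₁,…,rᵢ₋₁)M)`. Dimensions are Mathlib's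
`Module.supportDim` (Krull dimension of the support, in `WithBot ℕ∞`, `⊥` for the zero module —
"since `dim(∅) = -∞` … only the empty sequence is secant when `M = 0`"). Indices are `0`-based in
Lean: the condition at `i < rs.length` compares `M/(rs.take (i+1))M` with `M/(rs.take i)M`.
Meant for finite modules over Noetherian local rings and `rᵢ ∈ 𝔪`.
[cite: Cesnavicius2021, Def. 3.1 (i)] -/
def IsSecantSequence (rs : List R) : Prop :=
  ∀ i : ℕ, i < rs.length →
    supportDim R (M ⧸ (ofList (rs.take (i + 1)) • ⊤ : Submodule R M)) <
      supportDim R (M ⧸ (ofList (rs.take i) • ⊤ : Submodule R M))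

variable {M}

/-! ## Quotients by `(r₁,…,rᵢ)M`: bookkeeping -/

/-- `dim Supp(M/()M) = dim Supp M`. [folklore] -/
theorem supportDim_quotient_ofList_nil :
    supportDim R (M ⧸ (ofList ([] : List R) • ⊤ : Submodule R M)) = supportDim R M := by
  rw [ofList_nil, Submodule.bot_smul]
  exact supportDim_eq_of_equiv (Submodule.quotEquivOfEqBot ⊥ rfl)

/-- `dim Supp(M/(x, l)M) = dim Supp((M/xM)/(l)(M/xM))`. [folklore] -/
theorem supportDim_quotient_ofList_cons (x : R) (l : List R) :
    supportDim R (M ⧸ (ofList (x :: l) • ⊤ : Submodule R M)) =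
      supportDim R (QuotSMulTop x M ⧸ (ofList l • ⊤ : Submodule R (QuotSMulTop x M))) :=
  supportDim_eq_of_equiv (quotOfListConsSMulTopEquivQuotSMulTopInner M x l)

/-- `IsSecantSequence` is invariant under linear equivalences. [folklore] -/
theorem isSecantSequence_congr {M₂ : Type*} [AddCommGroup M₂] [Module R M₂] (e : M ≃ₗ[R] M₂)
    (rs : List R) : IsSecantSequence M rs ↔ IsSecantSequence M₂ rs := by
  have key : ∀ I : Ideal R, supportDim R (M ⧸ (I • ⊤ : Submodule R M)) =
      supportDim R (M₂ ⧸ (I • ⊤ : Submodule R M₂)) := fun I =>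
    supportDim_eq_of_equiv (Submodule.Quotient.equiv (I • ⊤) (I • ⊤) e
      (by rw [map_smul'', Submodule.map_top, LinearEquiv.range]))
  simp only [IsSecantSequence, key]

/-- The empty sequence is secant. [folklore] -/
theorem IsSecantSequence.nil : IsSecantSequence M ([] : List R) :=
  fun i hi => absurd hi (Nat.not_lt_zero i)

/-- For the zero module only the empty sequence is secant (Česnavičius 2021, Def. 3.1 (i):
"only the empty sequence is secant when `M = 0`"). [cite: Cesnavicius2021, Def. 3.1 (i)] -/
theorem isSecantSequence_iff_eq_nil_of_subsingleton [Subsingleton M] (rs : List R) :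
    IsSecantSequence M rs ↔ rs = [] := by
  refine ⟨fun h => ?_, fun h => h ▸ IsSecantSequence.nil⟩
  rcases rs with _ | ⟨x, rs⟩
  · rfl
  · exfalso
    have h0 := h 0 (by simp)
    rw [supportDim_eq_bot_of_subsingleton, supportDim_eq_bot_of_subsingleton] at h0
    exact lt_irrefl _ h0

/-- **Recursion for secant sequences**: `x, r₁, …, r_s` is secant for `M` iff
`dim Supp(M/xM) < dim Supp M` and `r₁, …, r_s` is secant for `M/xM`. [folklore] -/
theorem isSecantSequence_cons_iff (x : R) (rs : List R) :
    IsSecantSequence M (x :: rs) ↔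
      supportDim R (QuotSMulTop x M) < supportDim R M ∧
        IsSecantSequence (QuotSMulTop x M) rs := by
  have hD : ∀ j, supportDim R (M ⧸ (ofList ((x :: rs).take (j + 1)) • ⊤ : Submodule R M)) =
      supportDim R (QuotSMulTop x M ⧸
        (ofList (rs.take j) • ⊤ : Submodule R (QuotSMulTop x M))) := fun j => by
    rw [List.take_succ_cons]
    exact supportDim_quotient_ofList_cons x (rs.take j)
  constructor
  · intro h
    refine ⟨?_, fun j hj => ?_⟩
    · have h0 := h 0 (by simp)
      rwa [hD 0, List.take_zero, List.take_zero, supportDim_quotient_ofList_nil,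
        supportDim_quotient_ofList_nil] at h0
    · have := h (j + 1) (by simpa using hj)
      rwa [hD, hD] at this
  · rintro ⟨h0, h⟩ i hi
    rcases i with _ | j
    · rw [hD 0, List.take_zero, List.take_zero, supportDim_quotient_ofList_nil,
        supportDim_quotient_ofList_nil]
      exact h0
    · rw [hD, hD]
      exact h j (by simpa using hi)

/-- **Concatenation**: `rs₁ ++ rs₂` is secant for `M` iff `rs₁` is secant for `M` and `rs₂` is
secant for `M/(rs₁)M` — the form in which secant sequences are used downstream ("for any secant
for `M/(r₁,…,r_s)M` sequence `r'₁,…,r'_{s'}`", Česnavičius 2021, Thm. 3.10). [folklore] -/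
theorem isSecantSequence_append_iff :
    ∀ {M : Type v} [AddCommGroup M] [Module R M] (rs₁ rs₂ : List R),
      IsSecantSequence M (rs₁ ++ rs₂) ↔
        IsSecantSequence M rs₁ ∧
          IsSecantSequence (M ⧸ (ofList rs₁ • ⊤ : Submodule R M)) rs₂ := by
  intro M _ _ rs₁
  induction rs₁ generalizing M with
  | nil =>
    intro rs₂
    rw [List.nil_append]
    have e : (M ⧸ (ofList ([] : List R) • ⊤ : Submodule R M)) ≃ₗ[R] M := by
      rw [ofList_nil, Submodule.bot_smul]
      exact Submodule.quotEquivOfEqBot ⊥ rfl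
    rw [isSecantSequence_congr e rs₂]
    exact ⟨fun h => ⟨IsSecantSequence.nil, h⟩, fun h => h.2⟩
  | cons x rs₁ ih =>
    intro rs₂
    rw [List.cons_append, isSecantSequence_cons_iff, ih, isSecantSequence_cons_iff,
      isSecantSequence_congr (quotOfListConsSMulTopEquivQuotSMulTopInner M x rs₁) rs₂, and_assoc]

/-- **Initial segments of a secant sequence are secant.** [folklore] -/
theorem IsSecantSequence.take {rs : List R} (h : IsSecantSequence M rs) (j : ℕ) :
    IsSecantSequence M (rs.take j) := by
  rw [← List.take_append_drop j rs, isSecantSequence_append_iff] at h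
  exact h.1

/-- **Tails of a secant sequence are secant for the quotient**: if `rs` is secant for `M` then
`rs.drop j` is secant for `M/(rs.take j)M`. [folklore] -/
theorem IsSecantSequence.drop {rs : List R} (h : IsSecantSequence M rs) (j : ℕ) :
    IsSecantSequence (M ⧸ (ofList (rs.take j) • ⊤ : Submodule R M)) (rs.drop j) := by
  rw [← List.take_append_drop j rs, isSecantSequence_append_iff] at h
  exact h.2

/-! ## Arithmetic in `WithBot ℕ∞` -/

/-- In `WithBot ℕ∞`: `x < y ≤ x + 1` forces `y = x + 1`. [folklore] -/
theorem WithBotENat.eq_add_one_of_lt_of_le {x y : WithBot ℕ∞} (h₁ : x < y) (h₂ : y ≤ x + 1) :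
    y = x + 1 := by
  induction x using WithBot.recBotCoe with
  | bot => exact absurd (h₂.trans_lt (by simpa using h₁)) (lt_irrefl _)
  | coe a =>
    induction y using WithBot.recBotCoe with
    | bot => exact absurd h₁ (not_lt_bot)
    | coe b =>
      induction a using ENat.recTopCoe with
      | top => exact absurd (WithBot.coe_lt_coe.mp h₁) (not_top_lt)
      | coe m =>
        induction b using ENat.recTopCoe with
        | top =>
          exfalso
          have : ((⊤ : ℕ∞) : WithBot ℕ∞) ≤ ((m + 1 : ℕ) : ℕ∞) := by exact_mod_cast h₂
          exact absurd (WithBot.coe_le_coe.mp this) (by simp)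
        | coe n =>
          have h₁' : m < n := by exact_mod_cast h₁
          have h₂' : n ≤ m + 1 := by exact_mod_cast h₂
          have : n = m + 1 := le_antisymm h₂' h₁'
          subst this
          norm_cast

/-- In `WithBot ℕ∞`: `x + 1 = y + 1` implies `x = y`. [folklore] -/
theorem WithBotENat.add_one_cancel {x y : WithBot ℕ∞} (h : x + 1 = y + 1) : x = y := by
  induction x using WithBot.recBotCoe with
  | bot =>
    induction y using WithBot.recBotCoe with
    | bot => rfl
    | coe b =>
      have : (⊥ : WithBot ℕ∞) = ((b + 1 : ℕ∞) : WithBot ℕ∞) := by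
        rw [WithBot.bot_add] at h; rw [h]; norm_cast
      exact absurd this WithBot.bot_ne_coe
  | coe a =>
    induction y using WithBot.recBotCoe with
    | bot =>
      have : (⊥ : WithBot ℕ∞) = ((a + 1 : ℕ∞) : WithBot ℕ∞) := by
        rw [WithBot.bot_add] at h; rw [← h]; norm_cast
      exact absurd this WithBot.bot_ne_coe
    | coe b =>
      have h' : a + 1 = b + 1 := by exact_mod_cast h
      induction a using ENat.recTopCoe with
      | top =>
        induction b using ENat.recTopCoe with
        | top => rfl
        | coe n => exact absurd h' (by simpa using ENat.top_ne_coe (n + 1))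
      | coe m =>
        induction b using ENat.recTopCoe with
        | top => exact absurd h'.symm (by simpa using ENat.top_ne_coe (m + 1))
        | coe n =>
          have : m + 1 = n + 1 := by exact_mod_cast h'
          have : m = n := by omega
          subst this
          rfl

/-- In `WithBot ℕ∞`: if `x ≠ ⊥`, `y ≠ ⊤` and `x + 1 = y` then `x < y`. [folklore] -/
theorem WithBotENat.lt_of_add_one_eq {x y : WithBot ℕ∞} (hx : x ≠ ⊥) (hy : y ≠ ⊤)
    (h : x + 1 = y) : x < y := by
  induction x using WithBot.recBotCoe with
  | bot => exact absurd rfl hx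
  | coe a =>
    subst h
    induction a using ENat.recTopCoe with
    | top => exact absurd rfl hy
    | coe m =>
      exact_mod_cast (WithBot.coe_lt_coe.mpr (by exact_mod_cast Nat.lt_succ_self m))

/-! ## Secant sequences over a Noetherian local ring -/

section LocalRing

variable [IsNoetherianRing R] [IsLocalRing R] [Module.Finite R M]

omit [Module.Finite R M] in
/-- The support dimension of a module over a Noetherian local ring is not `⊤`. [folklore] -/
theorem supportDim_ne_top : supportDim R M ≠ ⊤ :=
  ((supportDim_le_ringKrullDim R M).trans_lt ringKrullDim_lt_top).ne

/-- **`dim Supp M ≤ dim Supp(M/(r₁,…,r_s)M) + s`** for `rᵢ ∈ 𝔪` (Česnavičius 2021, §3.2: "for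
every `1 ≤ i ≤ s`, we have `dim(Supp(M/(r₁,…,rᵢ₋₁)M)) - 1 ≤ dim(Supp(M/(r₁,…,rᵢ)M))`",
iterated; each step is Stacks 0B52). [cite: Cesnavicius2021, §3.2] -/
theorem supportDim_le_supportDim_quotient_add_length :
    ∀ {M : Type v} [AddCommGroup M] [Module R M] [Module.Finite R M] (rs : List R),
      (∀ r ∈ rs, r ∈ maximalIdeal R) →
        supportDim R M ≤ supportDim R (M ⧸ (ofList rs • ⊤ : Submodule R M)) + rs.length := by
  intro M _ _ _ rs
  induction rs generalizing M with
  | nil =>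
    intro _
    rw [supportDim_quotient_ofList_nil, List.length_nil, Nat.cast_zero, add_zero]
  | cons x rs ih =>
    intro hrs
    have hx : x ∈ maximalIdeal R := hrs x (by simp)
    calc supportDim R M ≤ supportDim R (QuotSMulTop x M) + 1 :=
          supportDim_le_supportDim_quotSMulTop_succ hx
      _ ≤ supportDim R (QuotSMulTop x M ⧸
            (ofList rs • ⊤ : Submodule R (QuotSMulTop x M))) + rs.length + 1 :=
          add_le_add (ih fun r hr => hrs r (List.mem_cons_of_mem x hr)) le_rfl
      _ = supportDim R (M ⧸ (ofList (x :: rs) • ⊤ : Submodule R M)) + (x :: rs).length := by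
          rw [supportDim_quotient_ofList_cons, List.length_cons, Nat.cast_succ, add_assoc]

/-- **A secant sequence drops the dimension by its length**: if `r₁,…,r_s ∈ 𝔪` is secant for
`M` then `dim Supp(M/(r₁,…,r_s)M) + s = dim Supp M` (Česnavičius 2021, §3.2: "`r₁,…,r_s` is
secant if and only if `dim(Supp(M/(r₁,…,r_s)M)) = dim(Supp(M)) - s`", direction ⇒).
[cite: Cesnavicius2021, §3.2] -/
theorem IsSecantSequence.supportDim_quotient_add_length_eq :
    ∀ {M : Type v} [AddCommGroup M] [Module R M] [Module.Finite R M] {rs : List R},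
      IsSecantSequence M rs → (∀ r ∈ rs, r ∈ maximalIdeal R) →
        supportDim R (M ⧸ (ofList rs • ⊤ : Submodule R M)) + rs.length = supportDim R M := by
  intro M _ _ _ rs
  induction rs generalizing M with
  | nil =>
    intro _ _
    rw [supportDim_quotient_ofList_nil, List.length_nil, Nat.cast_zero, add_zero]
  | cons x rs ih =>
    intro h hrs
    have hx : x ∈ maximalIdeal R := hrs x (by simp)
    obtain ⟨hlt, h'⟩ := (isSecantSequence_cons_iff x rs).mp h
    have hstep : supportDim R M = supportDim R (QuotSMulTop x M) + 1 :=
      WithBotENat.eq_add_one_of_lt_of_le hlt (supportDim_le_supportDim_quotSMulTop_succ hx)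
    rw [hstep, ← ih h' fun r hr => hrs r (List.mem_cons_of_mem x hr),
      supportDim_quotient_ofList_cons, List.length_cons, Nat.cast_succ, add_assoc]

/-- **Converse: a sequence in `𝔪` dropping the dimension of `M ≠ 0` by its length is secant**
(Česnavičius 2021, §3.2, direction ⇐ of "`r₁,…,r_s` is secant if and only if
`dim(Supp(M/(r₁,…,r_s)M)) = dim(Supp(M)) - s`"; the hypothesis `M ≠ 0` is implicit in the
source, where only the empty sequence is secant for `M = 0`). [cite: Cesnavicius2021, §3.2] -/
theorem isSecantSequence_of_supportDim_quotient_add_length_eq :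
    ∀ {M : Type v} [AddCommGroup M] [Module R M] [Module.Finite R M] [Nontrivial M]
      {rs : List R}, (∀ r ∈ rs, r ∈ maximalIdeal R) →
        supportDim R (M ⧸ (ofList rs • ⊤ : Submodule R M)) + rs.length = supportDim R M →
          IsSecantSequence M rs := by
  intro M _ _ _ _ rs
  induction rs generalizing M with
  | nil => intro _ _; exact IsSecantSequence.nil
  | cons x rs ih =>
    intro hrs heq
    have hx : x ∈ maximalIdeal R := hrs x (by simp)
    have hrs' : ∀ r ∈ rs, r ∈ maximalIdeal R := fun r hr => hrs r (List.mem_cons_of_mem x hr)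
    haveI : Nontrivial (QuotSMulTop x M) := nontrivial_quotSMulTop_of_mem_maximalIdeal M hx
    rw [supportDim_quotient_ofList_cons, List.length_cons, Nat.cast_succ, ← add_assoc] at heq
    -- `dim M ≤ dim M/xM + 1 ≤ dim (M/xM)/(rs) + s + 1 = dim M`
    have h1 : supportDim R M ≤ supportDim R (QuotSMulTop x M) + 1 :=
      supportDim_le_supportDim_quotSMulTop_succ hx
    have h2 : supportDim R (QuotSMulTop x M) + 1 ≤ supportDim R (QuotSMulTop x M ⧸
        (ofList rs • ⊤ : Submodule R (QuotSMulTop x M))) + rs.length + 1 :=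
      add_le_add (supportDim_le_supportDim_quotient_add_length rs hrs') le_rfl
    have e1 : supportDim R (QuotSMulTop x M) + 1 = supportDim R M :=
      le_antisymm (h2.trans heq.le) h1
    have e2 : supportDim R (QuotSMulTop x M) = supportDim R (QuotSMulTop x M ⧸
        (ofList rs • ⊤ : Submodule R (QuotSMulTop x M))) + rs.length :=
      WithBotENat.add_one_cancel (le_antisymm h2 (heq.le.trans h1))
    refine (isSecantSequence_cons_iff x rs).mpr ⟨?_, ih hrs' e2.symm⟩
    exact WithBotENat.lt_of_add_one_eq ((supportDim_ne_bot_iff_nontrivial R _).mpr inferInstance)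
      supportDim_ne_top e1

/-- **Secant sequences for `M ≠ 0` are characterized by the dimension drop**
(Česnavičius 2021, §3.2). [cite: Cesnavicius2021, §3.2] -/
theorem isSecantSequence_iff_supportDim_quotient_add_length_eq [Nontrivial M] {rs : List R}
    (hrs : ∀ r ∈ rs, r ∈ maximalIdeal R) :
    IsSecantSequence M rs ↔
      supportDim R (M ⧸ (ofList rs • ⊤ : Submodule R M)) + rs.length = supportDim R M :=
  ⟨fun h => h.supportDim_quotient_add_length_eq hrs,
    isSecantSequence_of_supportDim_quotient_add_length_eq hrs⟩

/-- **Any permutation of a secant sequence (in `𝔪`) is secant** (Česnavičius 2021, §3.2: "any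
permutation of a secant for `M` sequence `r₁,…,r_s` is still secant for `M`").
[cite: Cesnavicius2021, §3.2] -/
theorem IsSecantSequence.of_perm {rs rs' : List R} (h : IsSecantSequence M rs)
    (hp : rs.Perm rs') (hrs : ∀ r ∈ rs, r ∈ maximalIdeal R) : IsSecantSequence M rs' := by
  have hset : (ofList rs' : Ideal R) = ofList rs :=
    le_antisymm (Ideal.span_mono fun r hr => hp.symm.mem_iff.mp hr)
      (Ideal.span_mono fun r hr => hp.mem_iff.mp hr)
  rcases subsingleton_or_nontrivial M with hM | hM
  · rw [isSecantSequence_iff_eq_nil_of_subsingleton] at h ⊢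
    subst h
    exact List.perm_nil.mp hp.symm
  · have hrs' : ∀ r ∈ rs', r ∈ maximalIdeal R := fun r hr => hrs r (hp.symm.mem_iff.mp hr)
    refine isSecantSequence_of_supportDim_quotient_add_length_eq hrs' ?_
    rw [hset, ← hp.length_eq]
    exact h.supportDim_quotient_add_length_eq hrs

/-- **Every `M`-regular sequence is secant (for `M ≠ 0`)** (Česnavičius 2021, §3.2: "Any
`M`-regular sequence is secant if `M ≠ 0`"; here `IsRegular` includes `M/(r₁,…,r_s)M ≠ 0`,
which over a local ring forces `rᵢ ∈ 𝔪` and `M ≠ 0`). Proof: a regular sequence drops the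
dimension by exactly its length (Mathlib `supportDim_add_length_eq_supportDim_of_isRegular`).
[cite: Cesnavicius2021, §3.2] -/
theorem _root_.RingTheory.Sequence.IsRegular.isSecantSequence {rs : List R}
    (reg : RingTheory.Sequence.IsRegular M rs) : IsSecantSequence M rs := by
  haveI : Nontrivial M := reg.nontrivial
  have hrs : ∀ r ∈ rs, r ∈ maximalIdeal R := by
    intro r hr
    by_contra hu
    rw [mem_maximalIdeal, mem_nonunits_iff, not_not] at hu
    apply reg.top_ne_smul
    have htop : (ofList rs : Ideal R) = ⊤ :=
      Ideal.eq_top_of_isUnit_mem _ (Ideal.subset_span (show r ∈ {r | r ∈ rs} from hr)) hu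
    rw [htop, Submodule.top_smul]
  exact isSecantSequence_of_supportDim_quotient_add_length_eq hrs
    (supportDim_add_length_eq_supportDim_of_isRegular rs reg)

end LocalRing

end Literature.AlgebraicGeometry.Resolution
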